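import Summits.QuantumFields.BalabanUV.Beta.GAN24.AveragedPropagatorOneStepDecay
import Summits.QuantumFields.BalabanUV.Beta.GAN24.VectorRowDecayLetters

/-!
# G-an2-4 ∕ (CONV-C), road P2, route R2-S1, VECTOR LAYER, PART 10 — THE ONE-STEP DIFFERENCE KERNEL OF BAŁABAN's AVERAGED PROPAGATOR
# `c_n = Q_n𝒢_nQ_n*` AT `U = 1`, `a = 1` ON EVERY CUBIC UNIT TORUS DECAYS EXPONENTIALLY WITH THE RATE FACTOR IN FRONT — UNCONDITIONAL:
# `‖(c_{RN} − c_N)(i, i′)‖ ≤ K(d)·((R−1)∕(RN))·(2 + log(RN) + log N)·e^{−δ(d)·|i₁ − i′₁|_{T,∞}}`, every `N, R, N₀ ≥ 1`, every `d`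

Unit `b2b-balaban-gan24-p2` (gen 30), BINDER row G-an2-4 ∕ (CONV-C), road P2; crux team (2).  Part 9's END (`AveragedPropagatorOneStepDecay.
norm_covOp_succ_sub_apply_le`) displays the six vector `RowDecay` letters; at `a = 1` they are THEOREMS OF THE TREE — the G-an2-4 swarm's
`VectorRowDecayLetters.vectorRowDecay_one_cubic` (leaf-06 gen 36; bodies: NE3's `Entry110*Cubic`, leaf-03∕04's `entry112*` with `C(1 + log n)`),
filed on this seat's «INTERFACE REQUEST G-an2-4: (VECTOR-LETTERS-LOC)» within the hour.  THIS FILE plugs them in: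
 * §1 the algebra of Part 9's constant: `epsVec = epsA0 + epsA3·C₃′ + epsA4·C₄` (`epsVec_eq`), hence `epsVec_le_log` — with `C₃′ = C(1 + log(RN))`,
   `C₄ = C(1 + log N)` the constant is `≤ (epsA0 + (epsA3 + epsA4)·C)·(2 + log(RN) + log N)`;
 * §2 **`norm_covOp_succ_sub_apply_le_cubic`** — `∃ K δ₄ > 0` (functions of `d`) with, for all `N, R, N₀ ≥ 1` and all unit bonds `i, i′` of the cubic
   unit torus: `‖(covOp (R*N) T 1 − covOp N T 1) i i′‖ ≤ K·((R−1)∕(RN))·(2 + log(RN) + log N)·e^{−δ₄·|rep i₁ − rep i′₁|_{T,∞}}` — UNCONDITIONAL;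
 * §3 **`covOp_kernel_decay_cubic`** — the companion BOUND clause `‖(covOp n T 1) i i′‖ ≤ K·e^{−δ₄|…|}` for every `n ≥ 1` (the zeroth `RowDecay`
   letter read through `Q`, `Q*`), so that the pair is the (CONV-C) SHAPE — `k`-uniform decay ∧ one-step rate `((R−1)∕(RN))·log` with decay — for
   this VECTOR unit-lattice constituent.
READING.  With `N = L^k`, `R = L`: `|c_{k+1} − c_k|(y,y′) ≤ K′·(k+1)·L^{−k}·e^{−δ₄|y−y′|}` and `|c_k|(y,y′) ≤ K·e^{−δ₄|y−y′|}` — both (CONV-C) clauses, at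
the strong exponent up to the genuine log, for Bałaban's `Q_kG_kQ_k*` at `U = 1` on cubic tori, by a position-space argument that never estimates
the non-local `P` (Part 3's gauge collapse).  The tower∕`θ` packaging and the inverse `(Q𝒢Q*)⁻¹` in kernel currency are NOT in this file.
HONEST SCOPE.  Junction + elementary algebra; `U = 1`, `a = 1`, CUBIC unit tori, the unit-lattice-read constituent only; constants existential in `d`;
nothing of Bałaban's asserted ((1.99), (1.110) are TEXT LOCATIONS); NOT (CONV-C) as typed (a statement about `(G_k, H_k, C^{(k)})` incl. fine objects
at general `U`), NEVER «G-an2-4 closed», NOT NE2, NOT D1, NOT BetaPertH, NOT continuum, NOT Clay; not in print — our proof.  HONEST DEPENDENCY: continuum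
YM on T⁴ ⇐ BetaPertH ∧ nine spine estimates (0/9 proved); BetaPertH ⇐ (D1) ∧ (D4) ∧ CAP+tail; G-an2-4 gates asym, D1 and NE2/3/4.
-/

noncomputable section

open scoped BigOperators ComplexConjugate Matrix

namespace Summit.QuantumFields.BalabanUV.Beta.GAN24.AveragedPropagatorDecayCubic

open Literature.MathematicalPhysics.QuantumFieldTheory.Balaban1983to89
open B5Prop11Plancherel (Tor fine fdiff)
open B5Blocks16 (blockOf)
open B5DeltaA169 (DeltaA)
open B6LowerBound2153Torus (rep)
open B4TorusKernel.MultiPeriod (torusSupNorm)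
open B4Sect5Proof (latticeConst latticeConst_nonneg)
open Summit.QuantumFields.BalabanUV.Beta.GAN24.StaircaseAveragingDefect (ratio_nonneg)
open Summit.QuantumFields.BalabanUV.Beta.GAN24.AveragedPropagatorTwoLevel (covOp)
open Summit.QuantumFields.BalabanUV.Beta.GAN24.BlockFieldDecay (RowDecay FieldDecay fieldDecay_mulVec)
open Summit.QuantumFields.BalabanUV.Beta.GAN24.AveragedPropagatorOneStepDecay (epsVec norm_covOp_succ_sub_apply_le)
open Summit.QuantumFields.BalabanUV.Beta.GAN24.AveragedPropagatorLocality (fieldDecay_QvAdj fieldDecay_QvOp)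
open Summit.QuantumFields.BalabanUV.Beta.GAN24.VectorRowDecayLetters (vectorRowDecay_one_cubic)

/-! ## §1 The algebra of the constant -/

section Algebra

variable (d : ℕ)

/-- the `C₃′`-coefficient of `epsVec`. [folklore] -/
def epsA3 (C₂ δ : ℝ) : ℝ :=
  (1 + Real.exp (δ / 2 / 2)) * (((d : ℝ) + 1) * (C₂ * Real.exp δ * latticeConst (d + 1) (δ / 2)) * latticeConst (d + 1) (δ / 2 / 2)
    + ((d : ℝ) + 1) * ((d : ℝ) + 1) * Real.exp (δ / 2) * Real.exp (δ / 2) * C₂ * Real.exp δ * latticeConst (d + 1) (δ / 2)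
      * latticeConst (d + 1) (δ / 2 / 2))

/-- the `C₄`-coefficient of `epsVec`. [folklore] -/
def epsA4 (C₁' δ : ℝ) : ℝ :=
  (1 + Real.exp (δ / 2 / 2)) * (((d : ℝ) + 1) * (C₁' * Real.exp (δ / 2) * Real.exp δ * latticeConst (d + 1) (δ / 2)) * latticeConst (d + 1) (δ / 2 / 2)
    + ((d : ℝ) + 1) * C₁' * ((d : ℝ) + 1) * Real.exp (δ / 2) * Real.exp δ * latticeConst (d + 1) (δ / 2) * latticeConst (d + 1) (δ / 2 / 2))

/-- the `C₃′, C₄`-free part of `epsVec`. [folklore] -/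
def epsA0 (a C₀ C₀' δ : ℝ) : ℝ :=
  (1 + Real.exp (δ / 2 / 2)) * C₀' * (1 + Real.exp δ) * latticeConst (d + 1) (δ / 2 / 2)
  + (1 + Real.exp (δ / 2)) / 2 * C₀ * Real.exp δ * latticeConst (d + 1) (δ / 2)
  + (1 + Real.exp (δ / 2 / 2)) * (a * (C₀' * (1 + Real.exp (δ / 2)) ^ 2 * C₀ * Real.exp δ * latticeConst (d + 1) (δ / 2) * latticeConst (d + 1) (δ / 2 / 2)
      + C₀' * Real.exp (δ / 2) * (1 + Real.exp (δ / 2)) / 2 * C₀ * Real.exp δ * latticeConst (d + 1) (δ / 2) * latticeConst (d + 1) (δ / 2 / 2)))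

/-- **`epsVec` is affine in `C₃′` and `C₄`**: `epsVec = epsA0 + epsA3·C₃′ + epsA4·C₄`. [folklore] -/
theorem epsVec_eq (a C₀ C₀' C₁' C₂ C₃' C₄ δ : ℝ) :
    epsVec d a C₀ C₀' C₁' C₂ C₃' C₄ δ = epsA0 d a C₀ C₀' δ + epsA3 d C₂ δ * C₃' + epsA4 d C₁' δ * C₄ := by
  unfold epsVec epsA0 epsA3 epsA4
  ring

/-- `0 ≤ epsA0`, `0 ≤ epsA3`, `0 ≤ epsA4` for nonnegative letters, `a ≥ 0`, `δ > 0`. [folklore] -/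
theorem epsA_nonneg {a C₀ C₀' C₁' C₂ δ : ℝ} (ha : 0 ≤ a) (h0 : 0 ≤ C₀) (h0' : 0 ≤ C₀') (h1 : 0 ≤ C₁') (h2 : 0 ≤ C₂) (hδ : 0 < δ) :
    0 ≤ epsA0 d a C₀ C₀' δ ∧ 0 ≤ epsA3 d C₂ δ ∧ 0 ≤ epsA4 d C₁' δ := by
  have hK2 := latticeConst_nonneg (d + 1) (half_pos hδ).le
  have hK4 := latticeConst_nonneg (d + 1) (half_pos (half_pos hδ)).le
  unfold epsA0 epsA3 epsA4
  exact ⟨by positivity, by positivity, by positivity⟩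

/-- **THE LOG BOOKKEEPING**: with `C₃′ = C(1 + log(RN))`, `C₄ = C(1 + log N)` and `ℓ = 2 + log(RN) + log N ≥ 1` (both logs `≥ 0`):
`epsVec ≤ (epsA0 + (epsA3 + epsA4)·C)·ℓ`. [folklore] -/
theorem epsVec_le_log {a C₀ C₀' C₁' C₂ C δ lRN lN : ℝ} (ha : 0 ≤ a) (h0 : 0 ≤ C₀) (h0' : 0 ≤ C₀') (h1 : 0 ≤ C₁') (h2 : 0 ≤ C₂) (hC : 0 ≤ C)
    (hδ : 0 < δ) (hlRN : 0 ≤ lRN) (hlN : 0 ≤ lN) :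
    epsVec d a C₀ C₀' C₁' C₂ (C * (1 + lRN)) (C * (1 + lN)) δ
      ≤ (epsA0 d a C₀ C₀' δ + (epsA3 d C₂ δ + epsA4 d C₁' δ) * C) * (2 + lRN + lN) := by
  obtain ⟨hA0, hA3, hA4⟩ := epsA_nonneg d ha h0 h0' h1 h2 hδ
  rw [epsVec_eq]
  have e3 : epsA3 d C₂ δ * (C * (1 + lRN)) ≤ epsA3 d C₂ δ * C * (2 + lRN + lN) := by
    rw [← mul_assoc]; exact mul_le_mul_of_nonneg_left (by linarith) (mul_nonneg hA3 hC)
  have e4 : epsA4 d C₁' δ * (C * (1 + lN)) ≤ epsA4 d C₁' δ * C * (2 + lRN + lN) := by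
    rw [← mul_assoc]; exact mul_le_mul_of_nonneg_left (by linarith) (mul_nonneg hA4 hC)
  have e0 : epsA0 d a C₀ C₀' δ ≤ epsA0 d a C₀ C₀' δ * (2 + lRN + lN) := by nlinarith
  nlinarith

end Algebra

/-! ## §2 The one-step difference kernel on cubic tori at `a = 1` — UNCONDITIONAL -/

variable (d : ℕ)

/-- **THE ONE-STEP DIFFERENCE KERNEL OF BAŁABAN's AVERAGED PROPAGATOR `Q_k𝒢_kQ_k*` DECAYS, AT `U = 1`, `a = 1`, ON EVERY CUBIC UNIT TORUS —
UNCONDITIONAL**: `∃ K δ₄ > 0` (functions of `d`) such that for all `N, R, N₀ ≥ 1` and all unit bonds `i, i′` of `Π_{μ<d+1} ℤ∕N₀`: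
`‖(c_{RN} − c_N)(i, i′)‖ ≤ K·((R−1)∕(RN))·(2 + log(RN) + log N)·e^{−δ₄·|rep i₁ − rep i′₁|_{T,∞}}` (`c_n = covOp n T 1`). [folklore] -/
theorem norm_covOp_succ_sub_apply_le_cubic :
    ∃ K δ₄ : ℝ, 0 < K ∧ 0 < δ₄ ∧ ∀ (N R N₀ : ℕ) [NeZero N] [NeZero R] [NeZero N₀]
      (i i' : Tor (fun _ : Fin (d + 1) => N₀) × Fin (d + 1)),
        ‖(covOp (R * N) (fun _ : Fin (d + 1) => N₀) 1 - covOp N (fun _ : Fin (d + 1) => N₀) 1) i i'‖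
          ≤ K * (((R : ℝ) - 1) / ((R : ℝ) * N)) * (2 + Real.log ((R * N : ℕ) : ℝ) + Real.log (N : ℝ))
              * Real.exp (-(δ₄ * torusSupNorm (fun _ : Fin (d + 1) => N₀)
                  (rep (fun _ : Fin (d + 1) => N₀) i.1 - rep (fun _ : Fin (d + 1) => N₀) i'.1))) := by
  obtain ⟨C, δ, hC, hδ, hL⟩ := vectorRowDecay_one_cubic d
  obtain ⟨hA0, hA3, hA4⟩ := epsA_nonneg d zero_le_one hC.le hC.le hC.le hC.le hδ
  refine ⟨epsA0 d 1 C C δ + (epsA3 d C δ + epsA4 d C δ) * C + 1, δ / 4, by positivity, by positivity, ?_⟩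
  intro N R N₀ _ _ _ i i'
  have hN : 1 ≤ N := Nat.one_le_iff_ne_zero.mpr (NeZero.ne N)
  have hRN : 1 ≤ R * N := Nat.one_le_iff_ne_zero.mpr (NeZero.ne (R * N))
  have hlN : 0 ≤ Real.log (N : ℝ) := Real.log_nonneg (by exact_mod_cast hN)
  have hlRN : 0 ≤ Real.log ((R * N : ℕ) : ℝ) := Real.log_nonneg (by exact_mod_cast hRN)
  have hρ := ratio_nonneg N R
  have hδ2 : δ / 2 ≤ δ := by linarith
  -- the letters at the two levels (level `RN` lowered to rate `δ/2`)
  have hN' := fun μ ν => hL N N₀ μ ν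
  have hRN' := fun μ ν => hL (R * N) N₀ μ ν
  have key := norm_covOp_succ_sub_apply_le N R (fun _ : Fin (d + 1) => N₀) one_pos hδ
    (C₀ := C) (C₀' := C) (C₁' := C) (C₂ := C) (C₃' := C * (1 + Real.log ((R * N : ℕ) : ℝ))) (C₄ := C * (1 + Real.log (N : ℝ)))
    (hN' 0 0).1 (fun ν => (hN' 0 ν).2.2.1) (fun μ ν => (hN' μ ν).2.2.2.2)
    ((hRN' 0 0).1.mono le_rfl hC.le hδ2) (fun ν => (hRN' 0 ν).2.1.mono le_rfl hC.le hδ2)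
    (fun μ ν => (hRN' μ ν).2.2.2.1.mono le_rfl (by positivity) hδ2) i i'
  refine key.trans ?_
  have hE := Real.exp_pos (-(δ / 4 * torusSupNorm (fun _ : Fin (d + 1) => N₀)
    (rep (fun _ : Fin (d + 1) => N₀) i.1 - rep (fun _ : Fin (d + 1) => N₀) i'.1)))
  have hbound := epsVec_le_log d zero_le_one hC.le hC.le hC.le hC.le hC.le hδ hlRN hlN (a := 1) (C₀ := C) (C₀' := C)
  have hℓ : 0 ≤ 2 + Real.log ((R * N : ℕ) : ℝ) + Real.log (N : ℝ) := by linarith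
  calc (((R : ℝ) - 1) / ((R : ℝ) * N)) * epsVec d 1 C C C C (C * (1 + Real.log ((R * N : ℕ) : ℝ))) (C * (1 + Real.log (N : ℝ))) δ
          * Real.exp (-(δ / 4 * torusSupNorm (fun _ : Fin (d + 1) => N₀) (rep (fun _ : Fin (d + 1) => N₀) i.1 - rep (fun _ : Fin (d + 1) => N₀) i'.1)))
      ≤ (((R : ℝ) - 1) / ((R : ℝ) * N)) * ((epsA0 d 1 C C δ + (epsA3 d C δ + epsA4 d C δ) * C) * (2 + Real.log ((R * N : ℕ) : ℝ) + Real.log (N : ℝ)))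
          * Real.exp (-(δ / 4 * torusSupNorm (fun _ : Fin (d + 1) => N₀) (rep (fun _ : Fin (d + 1) => N₀) i.1 - rep (fun _ : Fin (d + 1) => N₀) i'.1))) :=
        mul_le_mul_of_nonneg_right (mul_le_mul_of_nonneg_left hbound hρ) hE.le
    _ ≤ _ := by
        have : (epsA0 d 1 C C δ + (epsA3 d C δ + epsA4 d C δ) * C) ≤ epsA0 d 1 C C δ + (epsA3 d C δ + epsA4 d C δ) * C + 1 := by linarith
        have h2 : 0 ≤ (((R : ℝ) - 1) / ((R : ℝ) * N)) * (2 + Real.log ((R * N : ℕ) : ℝ) + Real.log (N : ℝ)) := mul_nonneg hρ hℓ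
        nlinarith [mul_nonneg h2 hE.le]

/-! ## §3 The bound clause: the kernel of `c_n` itself decays, `k`-uniformly -/

/-- **THE KERNEL OF `c_n = Q_n𝒢_nQ_n*` DECAYS, UNIFORMLY IN `n`, AT `a = 1` ON EVERY CUBIC UNIT TORUS**: `∃ K δ₄ > 0` (functions of `d`) with
`‖(covOp n T 1) i i′‖ ≤ K·e^{−δ₄·|rep i₁ − rep i′₁|_{T,∞}}` for every `n, N₀ ≥ 1` — the zeroth `RowDecay` letter transported through `Q*` and `Q`
(Parts 8's `fieldDecay_QvAdj`, `fieldDecay_QvOp`). [folklore] -/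
theorem covOp_kernel_decay_cubic :
    ∃ K δ₄ : ℝ, 0 < K ∧ 0 < δ₄ ∧ ∀ (n N₀ : ℕ) [NeZero n] [NeZero N₀] (i i' : Tor (fun _ : Fin (d + 1) => N₀) × Fin (d + 1)),
      ‖(covOp n (fun _ : Fin (d + 1) => N₀) 1) i i'‖
        ≤ K * Real.exp (-(δ₄ * torusSupNorm (fun _ : Fin (d + 1) => N₀)
            (rep (fun _ : Fin (d + 1) => N₀) i.1 - rep (fun _ : Fin (d + 1) => N₀) i'.1))) := by
  obtain ⟨C, δ, hC, hδ, hL⟩ := vectorRowDecay_one_cubic d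
  have hK := latticeConst_nonneg (d + 1) (half_pos hδ).le
  refine ⟨(1 + Real.exp (δ / 2)) * (C * (Real.exp δ * 1) * latticeConst (d + 1) (δ / 2)) + 1, δ / 2, by positivity, by positivity, ?_⟩
  intro n N₀ _ _ i i'
  -- the indicator source at `i′`
  have hsrc : FieldDecay (fun _ : Fin (d + 1) => N₀) Prod.fst (Pi.single i' (1 : ℂ)) 1 δ i'.1 := by
    intro z
    by_cases hz : z = i'
    · rw [hz, Pi.single_eq_same, norm_one, sub_self, T4EtaRateOperatorTorus.torusSupNorm_zero, mul_zero, neg_zero, Real.exp_zero, mul_one]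
    · rw [Pi.single_eq_of_ne hz, norm_zero]; positivity
  have hq := fieldDecay_QvAdj n (fun _ : Fin (d + 1) => N₀) zero_le_one hδ.le hsrc
  have hu := fieldDecay_mulVec (hL n N₀ 0 0).1 hδ hq (by positivity)
  have hc := fieldDecay_QvOp n (fun _ : Fin (d + 1) => N₀) (by positivity) (half_pos hδ).le hu
  have key := hc i
  rw [Matrix.mulVec_mulVec, Matrix.mulVec_mulVec, ← covOp, Matrix.mulVec_single_one] at key
  refine key.trans ?_
  have hE := Real.exp_pos (-(δ / 2 * torusSupNorm (fun _ : Fin (d + 1) => N₀)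
    (rep (fun _ : Fin (d + 1) => N₀) i.1 - rep (fun _ : Fin (d + 1) => N₀) i'.1)))
  nlinarith

end Summit.QuantumFields.BalabanUV.Beta.GAN24.AveragedPropagatorDecayCubic

end
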